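import Summits.QuantumFields.BalabanUV.T4Continuum.Support.NE7SliceStepLinear
import Summits.QuantumFields.BalabanUV.T4Continuum.Support.NE7SliceStepLetters
import Summits.QuantumFields.BalabanUV.T4Continuum.Support.NE7CoarseCurvatureLetter
import Summits.QuantumFields.BalabanUV.T4Continuum.Support.NE3ResidualSliceRep
import Summits.QuantumFields.BalabanUV.T4Continuum.Support.NE3FramePotBoundW
import HarnessLib

/-!
# NE7SliceStepNonlinear — THE NONLINEAR STEP `L(j−1) ⇒ L(j)` OF THE REP♭ SUP INDUCTION ON THE T4 CARRIERS: a gauge pinned at the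
# level-`(j−1)` corners with links `a`-close to `1` is improved to a gauge PINNED AT THE LEVEL-`j` CORNERS whose links are
# `(9ρ₁ + 8η∕L^j)`-close to `1`, `ρ₁ = 2ρ + O((t+ρ+a)(ρ+a))`, `ρ = K₁L^j(ε + 128a²) + K₂(2β′ + C₂(2L^ja)²)∕L^j` — the linear step's rate at
# the INTRINSIC data (plaquette `ε`, level-`j` datum `β′`, corner segment `η`) plus quadratic junk (`NE7SliceStepNonlinear`)

Cell `pub-balaban`, lineage `t4-ne7-p1` (CRUX PROVER NE7 #1 = OWNER of row NE7), gen 73; brick (L-step) of the road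
`t4/b2b-balaban-t4-ne7-p1-g73/REP-FLAT-ROAD-v2.md` §2, assembling BY NAME: the linear step `NE7SliceStepLinear.sliceStep_linear` (row NE3's smooth
right inverse + the T4-tangent sup letter `NE7SliceSupFlat`), row NE3's k-free quadratic remainder of the iterated average at the flat background
(`NE3QuadRemainderSup.norm_relIter_sub_dirIter_le`, `cavgIter_vary_eq_vary_relIter_of_tower`) for the DATUM letter, the corner covariance of the average
(`NE3ResidualSliceRep.cavgIter_gaugeAct_of_cornerTrivial`), the plaquette-vs-curl letter (`NE7GradientCurrency.hol_vary_flat_plaqWord`,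
`norm_plaqRem_sub_plaqRem_le`), the gauge-step letters `NE7GaugeStepLetters` (no `‖τ‖²` term), and p2's corner-gauge interpolation (154e)
`NE7CornerGaugeInterpolation.exists_smooth_corner_gauge` for the PINNING.

THE STEP (dimension `d+1`, level `j = i+1 ≤ k+1`, `Λ = L^j`).  DATA: `V` unitary, `(L^{k+1}N)`-periodic, `SmallField V ε`, `LevelSmall (d+1) L k ε`; a unitary
periodic gauge `g` PINNED at the level-`i` corners (`g(L^i z) = 1`) with `‖V^g − 1‖ ≤ a` on every link; the intrinsic level data `‖cavgIter L j V − 1‖ ≤ β′` and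
`‖V(L^j z; straight segment of length L^j) − 1‖ ≤ η`.  CONSTRUCTION: `A := log V^g` (skew, `‖A‖ ≤ 2a`, flat curl `≤ ε + 128a²`, datum
`‖dirIter L j 1 A‖ ≤ 2β′ + C₂(2Λa)²` since `cavgIter L j V^g = cavgIter L j V` by pinning and `= exp(relIter L j 1 A)` by row NE3's consistency);
the linear step gives `σ` with `‖A − dσ‖ ≤ ρ`, `‖σ‖ ≤ t`; its skew part `τ` keeps both bounds; the gauge `e^{τ}·g` has links `≤ ρ₁ := 2ρ + 8(t + ρ + 2a)(ρ + 2a)`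
(`NE7GaugeStepLetters.norm_gaugeStep_link_sub_one_le`) and corner values `v(z) = e^{τ(L^j z)}` with nearest-neighbour oscillation `ω ≤ Λρ₁ + η` (corner
letter + straight transporters); the interpolant `w` of (154e) (`w(L^j z) = v(z)`, `‖∇w‖ ≤ 8ω∕Λ`) gives the new gauge `g′ := w⁻¹·e^{τ}·g`, PINNED at the
level-`j` corners, with **`‖V^{g′} − 1‖ ≤ ρ₁ + 8ω∕Λ = 9ρ₁ + 8η∕Λ`**.  All constants are those of the linear step (`K₁, K₂, K₃`, functions of `d`,
`card n`) and row NE3's `C₂ = 4(3+12(d+1))³∕rho0(d+1,L)²`; NOTHING depends on `k` or `N`.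

HONEST FRAMING (page 1): [folklore] bookkeeping over the tree BY NAME; 0 def, 0 sorry.  This is ONE step of OUR road to the SUP member of REP♭ at the
trivial flat datum; REP♭ is NOT proved here; (APE) NOT proved; NE7 NOT PRINTED ∕ NOT PROVED; spine PROVED 0∕9; finite T⁴ rung (B)+1 — NOT infinite
volume, NOT mass gap, NOT BetaPertH, NOT Clay.  PLACEMENT: our lemma, under `Summits/QuantumFields/BalabanUV/`.
Continuum YM on T⁴ ⇐ BetaPertH ∧ nine spine estimates (0/9 proved); BetaPertH ⇐ (D1) ∧ (D4) ∧ CAP+tail; G-an2-4 gates asym, D1 and NE2/3/4.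
-/

set_option autoImplicit false

open scoped BigOperators Matrix Matrix.Norms.L2Operator
open NormedSpace Finset

namespace Summit.QuantumFields.BalabanUV.T4Continuum.NE7SliceStepNonlinear

open Literature.MathematicalPhysics.QuantumFieldTheory.Balaban1983to89
open B7Prop1Explicit B7Prop2Explicit MatrixLog
open T4AveragingDeficitWall (IsUnitaryCfg IsSkewDir SmallField vary curlAt flat_mem_classes)
open T4AveragingDeficitWallBoundary (IsPeriodicCfg)
open AveragingDeficitPeriodicCounting (IsPeriodicDir)
open AveragingDeficitMultiLevelPrep (cavgIter LevelSmall)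
open BlockAveragePushDirSplit (flat)
open BlockAverageVaryDisc (rho0 rho0_pos)
open NE3TangentCovariantTower (dirIter cavgIter_flat)
open NE3EnergyShapes (IsUnitarySite IsPeriodicSite)
open NE3FramePotBound (isUnitaryCfg_flat)
open NE3FramePotBoundW (levelSmall_of_le)
open BlockAverageCurrent (smallField_gaugeAct)
open NE3ResidualSliceRep (cavgIter_gaugeAct_of_cornerTrivial isPeriodicCfg_gaugeAct)
open NE3QuadRemainderTower (relIter)
open NE3QuadRemainderSup (norm_relIter_sub_dirIter_le norm_relIter_le cavgIter_vary_eq_vary_relIter_of_tower relIter_skew_of_tower rho0_le_one)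
open NE7CoarseCurvatureLetter (levelSmall_zero curvSum_zero)
open NE7GradientCurrency (vary_flat_one_apply)
open NE7SliceStepLetters (norm_curlAt_flat_le_of_plaq two_mul_lt_log_two skewHalf_mem norm_sub_skewHalf_le norm_skewHalf_le
  norm_gaugeStep_links_le norm_corner_sub_corner_le exists_pinned_gauge)
open NE7SliceStepLinear (sliceStep_linear)

noncomputable section

variable {d : ℕ} {n : Type*} [Fintype n] [DecidableEq n]

/-! ## §1 The logarithmic chart -/

/-- **THE LOGARITHMIC CHART OF A PINNED SMALL GAUGE COPY** (§1–§3 of the step): for `V` in the multi-level class, `g` unitary periodic pinned at the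
level-`i` corners with `‖V^g − 1‖ ≤ a ≤ 1∕128`, and the level datum `‖cavgIter L (i+1) V − 1‖ ≤ β′ ≤ 1∕4`: `V^g = e^{A}` with `A` skew, periodic,
`‖A‖ ≤ 2a`, flat curl `≤ ε + 32(2a)²` and T4-linear datum `‖dirIter L (i+1) 1 A‖ ≤ 2β′ + C₂(L^{i+1}·2a)²` (row NE3's quadratic remainder at the flat
background + the corner covariance of the average). [folklore] -/
theorem logChart_data [Nonempty n] {L : ℕ} (hL : 2 ≤ L) (k N : ℕ) [NeZero N] {i : ℕ} (hik : i ≤ k)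
    {V : Site (d + 1) → Fin (d + 1) → (Matrix n n ℂ)ˣ} {ε : ℝ} (hVu : IsUnitaryCfg V) (hε : 0 ≤ ε) (hs : LevelSmall (d + 1) L k ε)
    (hVε : SmallField V ε) (hVP : IsPeriodicCfg V ((L ^ (k + 1) * N : ℕ) : ℤ))
    {g : Site (d + 1) → (Matrix n n ℂ)ˣ} (hgu : IsUnitarySite g) (hgP : IsPeriodicSite g ((L ^ (k + 1) * N : ℕ) : ℤ))
    (hgpin : ∀ z : Site (d + 1), g (((L ^ i : ℕ) : ℤ) • z) = 1)
    {a β' : ℝ} (ha : ∀ (y : Site (d + 1)) (κ : Fin (d + 1)), ‖((gaugeAct g V y κ : (Matrix n n ℂ)ˣ) : Matrix n n ℂ) - 1‖ ≤ a)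
    (hβ' : ∀ (z : Site (d + 1)) (κ : Fin (d + 1)), ‖((cavgIter L (i + 1) V z κ : (Matrix n n ℂ)ˣ) : Matrix n n ℂ) - 1‖ ≤ β')
    (ha128 : a ≤ 1 / 128) (hβ4 : β' ≤ 1 / 4)
    (hσl : 4 * (3 + 12 * ((d + 1 : ℕ) : ℝ)) ^ 2 * (L : ℝ) ^ (i + 1) * (2 * a) ≤ rho0 (d + 1) L ^ 2) :
    ∃ A : Site (d + 1) → Fin (d + 1) → Matrix n n ℂ,
      (∀ (y : Site (d + 1)) (κ : Fin (d + 1)), ((gaugeAct g V y κ : (Matrix n n ℂ)ˣ) : Matrix n n ℂ) = exp (A y κ)) ∧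
      IsSkewDir A ∧ IsPeriodicDir A ((L ^ (i + 1) * (L ^ (k - i) * N) : ℕ) : ℤ) ∧
      (∀ (y : Site (d + 1)) (κ : Fin (d + 1)), ‖A y κ‖ ≤ 2 * a) ∧
      (∀ (z : Site (d + 1)) (μ ν : Fin (d + 1)), ‖curlAt (flat (d := d + 1) (n := n)) A z μ ν‖ ≤ ε + 32 * (2 * a) ^ 2) ∧
      (∀ (z : Site (d + 1)) (κ : Fin (d + 1)), ‖dirIter L (i + 1) (flat (d := d + 1) (n := n)) A z κ‖
        ≤ 2 * β' + 4 * (3 + 12 * ((d + 1 : ℕ) : ℝ)) ^ 3 / rho0 (d + 1) L ^ 2 * ((L : ℝ) ^ (i + 1) * (2 * a)) ^ 2) := by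
  letI : CStarAlgebra (Matrix n n ℂ) := {}
  have hL1 : 1 ≤ L := by omega
  set N' : ℕ := L ^ (k - i) * N with hN'def
  haveI : NeZero N' := ⟨by rw [hN'def]; exact Nat.mul_ne_zero (pow_ne_zero _ (by omega)) (NeZero.ne N)⟩
  have hPer : L ^ (k + 1) * N = L ^ (i + 1) * N' := by
    rw [hN'def, ← mul_assoc, ← pow_add, show i + 1 + (k - i) = k + 1 by omega]
  have ha0 : 0 ≤ a := (norm_nonneg _).trans (ha 0 0)
  set s : ℝ := 2 * a with hsdef
  have hs0 : 0 ≤ s := by positivity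
  have hs64 : s ≤ 1 / 64 := by rw [hsdef]; linarith
  -- the links and their logarithms
  have hlinkU : ∀ (y : Site (d + 1)) (κ : Fin (d + 1)), gaugeAct g V y κ ∈ unitaryUnits (Matrix n n ℂ) := by
    intro y κ
    simp only [gaugeAct]
    exact (unitaryUnits _).mul_mem ((unitaryUnits _).mul_mem (hgu _) (hVu _ _)) ((unitaryUnits _).inv_mem (hgu _))
  set A : Site (d + 1) → Fin (d + 1) → Matrix n n ℂ := fun y κ => mlog ((gaugeAct g V y κ : (Matrix n n ℂ)ˣ) : Matrix n n ℂ) with hAdef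
  have hlink1 : ∀ (y : Site (d + 1)) (κ : Fin (d + 1)), ‖((gaugeAct g V y κ : (Matrix n n ℂ)ˣ) : Matrix n n ℂ) - 1‖ < 1 := fun y κ =>
    (ha y κ).trans_lt (by linarith)
  have hexpA : ∀ (y : Site (d + 1)) (κ : Fin (d + 1)), ((gaugeAct g V y κ : (Matrix n n ℂ)ˣ) : Matrix n n ℂ) = exp (A y κ) := fun y κ =>
    (exp_mlog (hlink1 y κ)).symm
  have hgA : vary (flat (d := d + 1) (n := n)) A 1 = gaugeAct g V := by
    funext y μ
    apply Units.ext
    rw [vary_flat_one_apply, val_expUnit, hexpA]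
  have hAs : IsSkewDir A := fun y μ =>
    skewAdjoint.mem_iff.mpr (star_mlog_eq_neg (mem_unitaryUnits.mp (hlinkU y μ)) ((ha y μ).trans (by linarith)))
  have hgVP : IsPeriodicCfg (gaugeAct g V) ((L ^ (k + 1) * N : ℕ) : ℤ) := isPeriodicCfg_gaugeAct hgP hVP
  have hAP' : IsPeriodicDir A ((L ^ (i + 1) * N' : ℕ) : ℤ) := by
    intro y κ μ
    simp only [hAdef]
    rw [← hPer, hgVP y κ μ]
  have hAn : ∀ (y : Site (d + 1)) (κ : Fin (d + 1)), ‖A y κ‖ ≤ s := fun y κ => by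
    rw [hsdef]
    exact (norm_mlog_le_two_mul ((ha y κ).trans (by linarith))).trans (by linarith [ha y κ])
  -- the flat curl
  have hsf : SmallField (gaugeAct g V) ε := smallField_gaugeAct hgu hVε
  have hcurl : ∀ (z : Site (d + 1)) (μ ν : Fin (d + 1)), ‖curlAt (flat (d := d + 1) (n := n)) A z μ ν‖ ≤ ε + 32 * s ^ 2 := by
    refine norm_curlAt_flat_le_of_plaq A hs0 hs64 hAn hε ?_
    intro x μ ν hμν
    rw [hgA]; exact hsf x μ ν hμν
  -- the datum: row NE3's tower at the flat background
  have hflatU : IsUnitaryCfg (flat (d := d + 1) (n := n)) := isUnitaryCfg_flat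
  have hflat0 : SmallField (flat (d := d + 1) (n := n)) 0 := (flat_mem_classes (d := d + 1) (n := n) le_rfl).2
  have hflatP : IsPeriodicCfg (flat (d := d + 1) (n := n)) ((L ^ (i + 1) * N' : ℕ) : ℤ) := fun _ _ _ => rfl
  have hls0 : LevelSmall (d + 1) L (i + 1) 0 := levelSmall_zero L (i + 1)
  have hcurv : NE3LinearisedAverageSup.curvSum (d + 1) L (i + 1) 0 ≤ 2 / 3 * L := by rw [curvSum_zero]; positivity
  have hσl' : 4 * (3 + 12 * ((d + 1 : ℕ) : ℝ)) ^ 2 * (L : ℝ) ^ (i + 1) * s ≤ rho0 (d + 1) L ^ 2 := by rw [hsdef]; exact hσl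
  have hx0 : (0 : ℝ) ≤ 0 := le_rfl
  have hvary : cavgIter L (i + 1) (vary (flat (d := d + 1) (n := n)) A 1)
      = vary (flat (d := d + 1) (n := n)) (relIter L (i + 1) (flat (d := d + 1) (n := n)) A) 1 := by
    have h := cavgIter_vary_eq_vary_relIter_of_tower hL hflatU hflatP hx0 hls0 hflat0 hcurv hAs hAP' hs0 hAn hσl' (k := i + 1) le_rfl
    rwa [cavgIter_flat] at h
  have hquad : ∀ (z : Site (d + 1)) (κ : Fin (d + 1)),
      ‖relIter L (i + 1) (flat (d := d + 1) (n := n)) A z κ - dirIter L (i + 1) (flat (d := d + 1) (n := n)) A z κ‖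
        ≤ 4 * (3 + 12 * ((d + 1 : ℕ) : ℝ)) ^ 3 / rho0 (d + 1) L ^ 2 * ((L : ℝ) ^ (i + 1) * s) ^ 2 := fun z κ =>
    norm_relIter_sub_dirIter_le hL hflatU hflatP hx0 hls0 hflat0 hcurv hAs hAP' hs0 hAn hσl' (i + 1) le_rfl z κ
  have hBsup : ∀ (z : Site (d + 1)) (κ : Fin (d + 1)),
      ‖relIter L (i + 1) (flat (d := d + 1) (n := n)) A z κ‖ ≤ 2 * (3 + 12 * ((d + 1 : ℕ) : ℝ)) * (L : ℝ) ^ (i + 1) * s := fun z κ =>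
    norm_relIter_le hL hflatU hflatP hx0 hls0 hflat0 hcurv hAs hAP' hs0 hAn hσl' le_rfl z κ
  -- pinning ⇒ the `(i+1)`-fold average of `V^g` is that of `V`
  have hgpin' : ∀ z : Site (d + 1), g (((L : ℤ) ^ (i + 1)) • z) = 1 := by
    intro z
    have h := hgpin ((L : ℤ) • z)
    rwa [smul_smul, show (((L ^ i : ℕ) : ℤ)) * (L : ℤ) = (L : ℤ) ^ (i + 1) by push_cast; ring] at h
  have hcavg : cavgIter L (i + 1) (gaugeAct g V) = cavgIter L (i + 1) V :=
    cavgIter_gaugeAct_of_cornerTrivial hL1 i hVu hε (levelSmall_of_le hik hs) hVε hgu hgpin'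
  have hlog2 : 2 * (3 + 12 * ((d + 1 : ℕ) : ℝ)) * (L : ℝ) ^ (i + 1) * s < Real.log 2 := by
    have hD : (1 : ℝ) ≤ ((d + 1 : ℕ) : ℝ) := by exact_mod_cast Nat.succ_le_succ (Nat.zero_le d)
    have h := two_mul_lt_log_two (Λs := (L : ℝ) ^ (i + 1) * s) hD (rho0_pos (d := d + 1) hL1).le
      (rho0_le_one (d := d + 1) hL1) (by rw [← mul_assoc]; exact hσl')
    rwa [← mul_assoc] at h
  have hBn : ∀ (z : Site (d + 1)) (κ : Fin (d + 1)), ‖relIter L (i + 1) (flat (d := d + 1) (n := n)) A z κ‖ ≤ 2 * β' := by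
    intro z κ
    have h := congr_arg (fun W : Site (d + 1) → Fin (d + 1) → (Matrix n n ℂ)ˣ => ((W z κ : (Matrix n n ℂ)ˣ) : Matrix n n ℂ)) hvary
    simp only [hgA, hcavg, vary_flat_one_apply, val_expUnit] at h
    have hB : relIter L (i + 1) (flat (d := d + 1) (n := n)) A z κ = mlog ((cavgIter L (i + 1) V z κ : (Matrix n n ℂ)ˣ) : Matrix n n ℂ) := by
      rw [h, B7BlockAvgLog.mlog_exp ((hBsup z κ).trans_lt hlog2)]
    rw [hB]
    exact (norm_mlog_le_two_mul ((hβ' z κ).trans (hβ4.trans (by norm_num)))).trans (by linarith [hβ' z κ])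
  refine ⟨A, hexpA, hAs, hAP', hAn, hcurl, fun z κ => ?_⟩
  calc ‖dirIter L (i + 1) (flat (d := d + 1) (n := n)) A z κ‖
      ≤ ‖relIter L (i + 1) (flat (d := d + 1) (n := n)) A z κ‖
        + ‖relIter L (i + 1) (flat (d := d + 1) (n := n)) A z κ - dirIter L (i + 1) (flat (d := d + 1) (n := n)) A z κ‖ := by
        rw [← norm_neg (_ - dirIter L (i + 1) _ A z κ), neg_sub]; exact norm_le_insert' _ _
    _ ≤ 2 * β' + 4 * (3 + 12 * ((d + 1 : ℕ) : ℝ)) ^ 3 / rho0 (d + 1) L ^ 2 * ((L : ℝ) ^ (i + 1) * s) ^ 2 := add_le_add (hBn z κ) (hquad z κ)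

/-! ## §2 THE NONLINEAR STEP -/

/-- **THE STEP `L(j−1) ⇒ L(j)` OF THE SUP INDUCTION** (dimension `d+1`, level `j = i+1 ≤ k+1`, `Λ = L^{i+1}`; see the module doc).  With the linear
step's constants `K₁, K₂, K₃` (functions of `d`, `card n`): from a gauge `g` pinned at the level-`i` corners with links `a`-close to `1`, level data `β′`, `η`,
and the rates `ρ = K₁Λ(ε + 32(2a)²) + K₂(2β′ + C₂(Λ·2a)²)∕Λ`, `t = K₃(Λ·2a + (2β′ + C₂(Λ·2a)²) + Λ²(ε + 32(2a)²))`, under the displayed smallness lines, a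
gauge `g′` pinned at the level-`(i+1)` corners with ALL links `(9ρ₁ + 8η∕Λ)`-close to `1`, `ρ₁ = 2ρ + 8(t + (ρ + 2a))(ρ + 2a)`. [folklore] -/
theorem sliceStep_nonlinear [Nonempty n] :
    ∃ K₁ K₂ K₃ : ℝ, 0 < K₁ ∧ 0 < K₂ ∧ 0 < K₃ ∧ ∀ (L : ℕ), 2 ≤ L → ∀ (k N : ℕ) [NeZero N] (i : ℕ), i ≤ k →
      ∀ (V : Site (d + 1) → Fin (d + 1) → (Matrix n n ℂ)ˣ) (ε : ℝ), IsUnitaryCfg V → 0 ≤ ε → LevelSmall (d + 1) L k ε → SmallField V ε →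
        IsPeriodicCfg V ((L ^ (k + 1) * N : ℕ) : ℤ) →
      ∀ (g : Site (d + 1) → (Matrix n n ℂ)ˣ), IsUnitarySite g → IsPeriodicSite g ((L ^ (k + 1) * N : ℕ) : ℤ) →
        (∀ z : Site (d + 1), g (((L ^ i : ℕ) : ℤ) • z) = 1) →
      ∀ (a β' η : ℝ), (∀ (y : Site (d + 1)) (κ : Fin (d + 1)), ‖((gaugeAct g V y κ : (Matrix n n ℂ)ˣ) : Matrix n n ℂ) - 1‖ ≤ a) →
        (∀ (z : Site (d + 1)) (κ : Fin (d + 1)), ‖((cavgIter L (i + 1) V z κ : (Matrix n n ℂ)ˣ) : Matrix n n ℂ) - 1‖ ≤ β') →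
        (∀ (z : Site (d + 1)) (κ : Fin (d + 1)),
          ‖((hol V (((L ^ (i + 1) : ℕ) : ℤ) • z) (seg κ ((L ^ (i + 1) : ℕ) : ℤ)) : (Matrix n n ℂ)ˣ) : Matrix n n ℂ) - 1‖ ≤ η) →
        a ≤ 1 / 128 → β' ≤ 1 / 4 →
        4 * (3 + 12 * ((d + 1 : ℕ) : ℝ)) ^ 2 * (L : ℝ) ^ (i + 1) * (2 * a) ≤ rho0 (d + 1) L ^ 2 →
      ∀ (ρ t : ℝ),
        ρ = K₁ * (L : ℝ) ^ (i + 1) * (ε + 32 * (2 * a) ^ 2)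
            + K₂ * (2 * β' + 4 * (3 + 12 * ((d + 1 : ℕ) : ℝ)) ^ 3 / rho0 (d + 1) L ^ 2 * ((L : ℝ) ^ (i + 1) * (2 * a)) ^ 2) / (L : ℝ) ^ (i + 1) →
        t = K₃ * ((L : ℝ) ^ (i + 1) * (2 * a)
            + (2 * β' + 4 * (3 + 12 * ((d + 1 : ℕ) : ℝ)) ^ 3 / rho0 (d + 1) L ^ 2 * ((L : ℝ) ^ (i + 1) * (2 * a)) ^ 2)
            + ((L : ℝ) ^ (i + 1)) ^ 2 * (ε + 32 * (2 * a) ^ 2)) →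
        ρ + 2 * a ≤ 1 / 4 → t ≤ 1 / 4 →
        300 * ((d + 1 : ℕ) : ℝ) * ((L : ℝ) ^ (i + 1) * (2 * ρ + 8 * (t + (ρ + 2 * a)) * (ρ + 2 * a)) + η) ≤ 1 →
      ∃ g' : Site (d + 1) → (Matrix n n ℂ)ˣ,
        IsUnitarySite g' ∧ IsPeriodicSite g' ((L ^ (k + 1) * N : ℕ) : ℤ) ∧
        (∀ z : Site (d + 1), g' (((L ^ (i + 1) : ℕ) : ℤ) • z) = 1) ∧
        (∀ (y : Site (d + 1)) (κ : Fin (d + 1)), ‖((gaugeAct g' V y κ : (Matrix n n ℂ)ˣ) : Matrix n n ℂ) - 1‖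
          ≤ 9 * (2 * ρ + 8 * (t + (ρ + 2 * a)) * (ρ + 2 * a)) + 8 * η / (L : ℝ) ^ (i + 1)) := by
  letI : CStarAlgebra (Matrix n n ℂ) := {}
  letI : NormedAlgebra ℚ (Matrix n n ℂ) := NormedAlgebra.restrictScalars ℚ ℝ (Matrix n n ℂ)
  obtain ⟨K₁, K₂, K₃, hK₁, hK₂, hK₃, hSL⟩ := sliceStep_linear (d := d) (n := n)
  refine ⟨K₁, K₂, K₃, hK₁, hK₂, hK₃, ?_⟩
  intro L hL k N _ i hik V ε hVu hε hs hVε hVP g hgu hgP hgpin a β' η ha hβ' hη ha128 hβ4 hσl ρ t hρ ht hρa ht4 hωd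
  have hL1 : 1 ≤ L := by omega
  have hΛ1 : 1 ≤ L ^ (i + 1) := Nat.one_le_pow _ _ hL1
  have hΛr : ((L ^ (i + 1) : ℕ) : ℝ) = (L : ℝ) ^ (i + 1) := by push_cast; ring
  have hPer : L ^ (k + 1) * N = L ^ (i + 1) * (L ^ (k - i) * N) := by
    rw [← mul_assoc, ← pow_add, show i + 1 + (k - i) = k + 1 by omega]
  -- §1–§3 the logarithmic chart
  obtain ⟨A, hexpA, hAs, hAP, hAn, hcurl, hdatum⟩ :=
    logChart_data hL k N hik hVu hε hs hVε hVP hgu hgP hgpin ha hβ' ha128 hβ4 hσl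
  -- §4 the linear step at level `i + 1` on the torus of period `L^{i+1}·(L^{k−i}N)`
  haveI : NeZero (L ^ (k - i) * N) := ⟨Nat.mul_ne_zero (pow_ne_zero _ (by omega)) (NeZero.ne N)⟩
  obtain ⟨σ, hσP, hσA, hσn⟩ := hSL L hL i (L ^ (k - i) * N) A hAP (2 * a) hAn _ hcurl _ hdatum
  -- §5 the skew gauge function and the gauge step
  set τ : Site (d + 1) → Matrix n n ℂ := fun y => (1 / 2 : ℝ) • (σ y - star (σ y)) with hτdef
  have hτs : ∀ y, τ y ∈ skewAdjoint (Matrix n n ℂ) := fun y => skewHalf_mem (σ y)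
  have hτn : ∀ y, ‖τ y‖ ≤ t := fun y => (norm_skewHalf_le (σ y)).trans ((hσn y).trans_eq ht.symm)
  have hτA : ∀ (y : Site (d + 1)) (κ : Fin (d + 1)), ‖A y κ - (τ (y + e κ) - τ y)‖ ≤ ρ := by
    intro y κ
    have hid : τ (y + e κ) - τ y = (1 / 2 : ℝ) • ((σ (y + e κ) - σ y) - star (σ (y + e κ) - σ y)) := by
      simp only [hτdef, star_sub, smul_sub]; abel
    rw [hid]
    exact (norm_sub_skewHalf_le (hAs y κ) _).trans ((hσA y κ).trans_eq hρ.symm)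
  have hτP : ∀ (y : Site (d + 1)) (ι : Fin (d + 1)), τ (y + ((L ^ (k + 1) * N : ℕ) : ℤ) • e ι) = τ y := by
    intro y ι
    simp only [hτdef]
    rw [hPer, hσP]
  set G : Site (d + 1) → (Matrix n n ℂ)ˣ := fun y => expUnit (τ y) * g y with hGdef
  have hu₁U : ∀ y, expUnit (τ y) ∈ unitaryUnits (Matrix n n ℂ) := fun y =>
    mem_unitaryUnits.mpr (by rw [val_expUnit]; exact exp_mem_unitary_of_mem_skewAdjoint (hτs y))
  have hGu : IsUnitarySite G := fun y => (unitaryUnits _).mul_mem (hu₁U y) (hgu y)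
  have hGP : IsPeriodicSite G ((L ^ (i + 1) * (L ^ (k - i) * N) : ℕ) : ℤ) := by
    intro y ι
    simp only [hGdef]
    rw [← hPer, hτP, hgP y ι]
  have hGfac : gaugeAct G V = gaugeAct (fun y => expUnit (τ y)) (gaugeAct g V) := by
    funext y μ
    simp only [hGdef, gaugeAct, mul_inv_rev, mul_assoc]
  set ρ₁ : ℝ := 2 * ρ + 8 * (t + (ρ + 2 * a)) * (ρ + 2 * a) with hρ₁def
  have hlinks : ∀ (y : Site (d + 1)) (κ : Fin (d + 1)), ‖((gaugeAct G V y κ : (Matrix n n ℂ)ˣ) : Matrix n n ℂ) - 1‖ ≤ ρ₁ := by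
    intro y κ
    rw [hGfac]
    exact norm_gaugeStep_links_le hexpA hτs hAn hτn hτA ht4 hρa y κ
  -- §6 the corner oscillation
  have hgpinΛ : ∀ z : Site (d + 1), g (((L ^ (i + 1) : ℕ) : ℤ) • z) = 1 := by
    intro z
    have h := hgpin ((L : ℤ) • z)
    rwa [smul_smul, show (((L ^ i : ℕ) : ℤ)) * (L : ℤ) = ((L ^ (i + 1) : ℕ) : ℤ) by push_cast; ring] at h
  have hω : ∀ (z : Site (d + 1)) (ι : Fin (d + 1)),
      ‖(G (((L ^ (i + 1) : ℕ) : ℤ) • (z + e ι)) : Matrix n n ℂ) - G (((L ^ (i + 1) : ℕ) : ℤ) • z)‖ ≤ (L : ℝ) ^ (i + 1) * ρ₁ + η := by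
    intro z ι
    have h := norm_corner_sub_corner_le hVu hGu hlinks z ι (hη z ι)
    rwa [hΛr] at h
  -- §7 pin
  have hωd' : 300 * ((d + 1 : ℕ) : ℝ) * ((L : ℝ) ^ (i + 1) * ρ₁ + η) ≤ 1 := by rw [hρ₁def]; exact hωd
  obtain ⟨g', hg'u, hg'P, hg'pin, hg'links⟩ := exists_pinned_gauge (V := V) hGu hΛ1 hGP hlinks hω hωd'
  refine ⟨g', hg'u, fun y ι => by rw [hPer]; exact hg'P y ι, hg'pin, fun y κ => (hg'links y κ).trans (le_of_eq ?_)⟩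
  rw [hΛr, hρ₁def]
  field_simp
  ring

end

end Summit.QuantumFields.BalabanUV.T4Continuum.NE7SliceStepNonlinear
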